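import Literature.Analysis.FluidPDE.CheskidovTotalDissipation
import Literature.Analysis.FluidPDE.TwoHalfWeakLimits
import Literature.Analysis.FluidPDE.CheskidovAssemblyTools
import Literature.Analysis.FluidPDE.WeakSolutionSingularTime
import HarnessLib

/-!
# Cheskidov's no-dissipation-anomaly family: the `2½`-dimensional Navier–Stokes family on `T³`

Topic `Literature/Analysis/FluidPDE`. First half of the `2½`-dimensional assembly of Cheskidov
2023, Thm. 2.1 (second subfamily, `e = 0`) from the planar clauses of
`Literature.Analysis.FluidPDE.cheskidov_noAnomaly_family` (`CheskidovNoAnomalyFamily.lean`): the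
clauses of `Literature.Barriers.AnomalousDissipation.Cheskidov2023_thm21_noDissipationAnomaly`
about the Navier–Stokes family `u^m = (v^m, θ^m) ∘ π` (source, §4 p. 12, "`u^m(t) = (v^m(t),
θ^m(t))` with force `f^m = (g^m, 0)`") are derived here as statements about explicit planar data:

* `Cheskidov.isClassicalNSSolutionOn_family` — `u^m` solves (NSE) on `[0,2] × T³` with viscosity
  `ν_m`, zero pressure and the residual force `Torus.twoHalfForce` (accepted
  `Torus.isClassicalNSSolutionOn_twoHalf`), whose value on `[0,2]` is the horizontal lift of
  `g^m = ∂ₜv^m + (v^m·∇)v^m - ν_mΔv^m` (`Cheskidov.twoHalfForce_eq_twoHalf_nsBodyForce`, the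
  vertical component being the advection–diffusion residual `= 0`);
* `Cheskidov.tendsto_iSup_eBoundedHolderNorm_force_sub` — `f^m → f = (g, 0)` in
  `C([0,2]; C^α(T³))` from the planar `g^m → g` (p. 10);
* `Cheskidov.tendsto_eLpNorm_scalar`, `Cheskidov.tendsto_integral_sq_scalar`,
  `Cheskidov.tendsto_eLpNorm_family` — `‖θ^m(t)‖_{L²} → 1` on `[0,2]` from
  `sup_t ‖θ^m(t) - ρ^m(t)‖_{L²} → 0` and `‖ρ^m(t)‖_{L²} = 1` ((4.3), (4.20)), hence
  `‖u^m(t)‖_{L²} → 1` on `[1,2]` where `v^m = 0` (Thm. 2.1: `E(t) = 1 ≠ 0 = ‖u(t)‖²`);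
* `Cheskidov.tendsto_cumulativeDissipation_family` — `ν_m ∫₀ᵗ ‖∇u^m‖² → 0` on `[0,2]`
  (Lemma 3.2: `‖∇u^m‖² = ‖∇v^m‖² + ‖∇θ^m‖²`, (3.16), and the energy equality of `θ^m`);
* `Cheskidov.tendsto_integral_inner_family_of_mem_Icc` — `u^m(t) ⇀ 0` weakly in `L²(T³)` for
  `t ∈ [1,2]` (vanishing Fourier modes of the frozen mixed scalar `ρ^m(1)`, `‖ρ^m(1)‖_{Ḣ⁻¹} → 0`
  with zero mean, (3.6), transported to `θ^m(t)` by the `L²` estimate and lifted to `T³`).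

## References

* A. Cheskidov, arXiv:2311.04182 (2023), Thm. 2.1, Lemma 3.2, (3.6), (3.13), (3.16), §4 pp. 12–13.
-/

noncomputable section

open MeasureTheory Set Filter UnitAddTorus
open _root_.Topology
open scoped ENNReal NNReal InnerProductSpace
open Literature.Analysis.FunctionSpaces.Torus (twoHalf planarProj planarProjE planarEmbed)

namespace Literature.Analysis.FluidPDE.Cheskidov

open Literature.Analysis.FunctionSpaces

/-! ## The Navier–Stokes family `u^m = (v^m, θ^m) ∘ π` -/

section Family

variable {ν : ℕ → ℝ} {v : ℕ → ℝ → UnitAddTorus (Fin 2) → EuclideanSpace ℝ (Fin 2)}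
  {θ ρ : ℕ → ℝ → UnitAddTorus (Fin 2) → ℝ} {g : ℝ → UnitAddTorus (Fin 2) → EuclideanSpace ℝ (Fin 2)}

/-- On `[0,2]` the residual force of the ansatz `u^m = (v^m, θ^m) ∘ π` with zero pressure is the
horizontal lift of `g^m = ∂ₜv^m + (v^m·∇)v^m - ν_mΔv^m` (`Torus.nsBodyForce`): the vertical
residual `∂ₜθ^m + v^m·∇θ^m - ν_mΔθ^m` vanishes by the advection–diffusion equation, and the
one-sided time derivative within `[0,2]` of the globally smooth `v^m` is the two-sided one
(Cheskidov 2023, (3.13)). [cite: Cheskidov2023, (3.13)] -/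
theorem twoHalfForce_eq_twoHalf_nsBodyForce {m : ℕ}
    (hvS : FunctionSpaces.Torus.IsSmoothSpaceTimeOn univ (v m))
    (hθ : Torus.IsClassicalScalarTransportOn (Icc 0 2) (ν m) (v m) (θ m)) {t : ℝ} (ht : t ∈ Icc (0 : ℝ) 2) :
    Torus.twoHalfForce (Icc 0 2) (ν m) (v m) (θ m) (fun _ _ => 0) t =
      twoHalf (Torus.nsBodyForce (ν m) (v m) t) 0 := by
  have hvC := hvS
  unfold FunctionSpaces.Torus.IsSmoothSpaceTimeOn at hvC
  rw [univ_prod_univ, contDiffOn_univ] at hvC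
  funext x
  rw [Torus.twoHalfForce_apply]
  have h1 : ∀ y, FunctionSpaces.Torus.timeDerivWithin (Icc 0 2) (v m) t y =
      FunctionSpaces.Torus.timeDerivWithin univ (v m) t y := fun y => by
    rw [FunctionSpaces.Torus.timeDerivWithin_eq_timeDeriv_of_contDiff hvC (uniqueDiffOn_Icc zero_lt_two) ht,
      FunctionSpaces.Torus.timeDerivWithin, FunctionSpaces.Torus.timeDeriv, derivWithin_univ]
  have h2 : ∀ y, FunctionSpaces.Torus.gradient (fun _ : UnitAddTorus (Fin 2) => (0 : ℝ)) y = 0 := fun y =>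
    gradient_fun_const (0 : EuclideanSpace ℝ (Fin 2)) (0 : ℝ)
  have h3 : ∀ y, FunctionSpaces.Torus.timeDerivWithin (Icc 0 2) (θ m) t y +
      ⟪v m t y, FunctionSpaces.Torus.gradient (θ m t) y⟫_ℝ - ν m * FunctionSpaces.Torus.laplacian (θ m t) y = 0 :=
    fun y => sub_eq_zero.2 (hθ.transport t ht y)
  simp only [twoHalf, h1, h2, h3, add_zero, Torus.nsBodyForce, Pi.zero_apply]

/-- **The Navier–Stokes family.** For every `m`, `u^m(t) = (v^m(t), θ^m(t)) ∘ π` is a classical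
solution on `[0,2] × T³` of the Navier–Stokes system with viscosity `ν_m`, zero pressure and the
residual force of the ansatz, and `u^m(0) = (0, ρ_in) ∘ π` (Cheskidov 2023, §4 p. 12: "the smooth
solutions of the (NSE) on `[0,2]` will be given by `u^m(t) = (v^m(t), θ^m(t))` … since `v^m(0) = 0`
for every `m`, the initial data is given by `u^m(0) = u_in = (0, ρ_in)`"). [cite: Cheskidov2023, §4 p. 12] -/
theorem isClassicalNSSolutionOn_family {ρin : UnitAddTorus (Fin 2) → ℝ} {m : ℕ}
    (hvS : FunctionSpaces.Torus.IsSmoothSpaceTimeOn univ (v m))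
    (hv0 : ∀ t ∉ Ioo (0 : ℝ) 1, v m t = 0)
    (hθ : Torus.IsClassicalScalarTransportOn (Icc 0 2) (ν m) (v m) (θ m)) (hθ0 : θ m 0 = ρin) :
    FunctionSpaces.Torus.IsClassicalNSSolutionOn (Icc 0 2) (ν m)
        (Torus.twoHalfForce (Icc 0 2) (ν m) (v m) (θ m) (fun _ _ => 0))
        (fun t => twoHalf (v m t) (θ m t)) (fun _ => (fun _ : UnitAddTorus (Fin 2) => (0 : ℝ)) ∘ planarProj) ∧
      twoHalf (v m 0) (θ m 0) = twoHalf 0 ρin := by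
  refine ⟨Torus.isClassicalNSSolutionOn_twoHalf (uniqueDiffOn_Icc zero_lt_two) (ν m)
    (hvS.mono (subset_univ _)) hθ.smooth_scalar
    (FunctionSpaces.Torus.isSmoothSpaceTimeOn_const (FunctionSpaces.Torus.isSmooth_const (0 : ℝ)) _)
    (fun t ht => hθ.divFree t ht), ?_⟩
  rw [hv0 0 (fun h => lt_irrefl (0 : ℝ) h.1), hθ0]

/-- **Convergence of the forces** `f^m → f = (g, 0)` in `C([0,2]; C^α(T³))`: on `[0,2]`,
`f^m - f` is the horizontal lift of `g^m - g`, whose `C^{0,α}(T³)` norm is at most the planar one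
(`Torus.eBoundedHolderNorm_twoHalf_zero_right_le`); Cheskidov 2023, p. 10 (`g^m → g` in
`C([0,1]; C^α)`, both vanishing on `[1,2]`) and Thm. 2.1 (`f^ν → f` in `C([0,2]; C^α)`). [cite: Cheskidov2023, p. 10 and Thm. 2.1] -/
theorem tendsto_iSup_eBoundedHolderNorm_force_sub
    (hvS : ∀ m, FunctionSpaces.Torus.IsSmoothSpaceTimeOn univ (v m))
    (hθ : ∀ m, Torus.IsClassicalScalarTransportOn (Icc 0 2) (ν m) (v m) (θ m)) {α : ℝ≥0}
    (hg : Tendsto (fun m => ⨆ t ∈ Icc (0 : ℝ) 2,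
      eBoundedHolderNorm α (Torus.nsBodyForce (ν m) (v m) t - g t)) atTop (𝓝 0)) :
    Tendsto (fun m => ⨆ t ∈ Icc (0 : ℝ) 2, eBoundedHolderNorm α
      (Torus.twoHalfForce (Icc 0 2) (ν m) (v m) (θ m) (fun _ _ => 0) t - twoHalf (g t) 0)) atTop (𝓝 0) := by
  refine tendsto_of_tendsto_of_tendsto_of_le_of_le tendsto_const_nhds hg (fun _ => zero_le)
    (fun m => iSup₂_mono fun t ht => ?_)
  rw [twoHalfForce_eq_twoHalf_nsBodyForce (hvS m) (hθ m) ht, ← FunctionSpaces.Torus.twoHalf_sub, sub_zero]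
  exact Torus.eBoundedHolderNorm_twoHalf_zero_right_le α _

/-- `‖θ^m(t)‖_{L²} → 1` for every `t ∈ [0,2]`, from `sup_t ‖θ^m(t) - ρ^m(t)‖_{L²} → 0` and
`‖ρ^m(t)‖_{L²} = 1` (Cheskidov 2023, (4.3) and (4.20): "`‖θ^m(2)‖_{L²} → ‖ρ^m(2)‖_{L²} = 1`"). [cite: Cheskidov2023, (4.3) and (4.20)] -/
theorem tendsto_eLpNorm_scalar
    (hθ : ∀ m, Torus.IsClassicalScalarTransportOn (Icc 0 2) (ν m) (v m) (θ m))
    (hρ : ∀ m, Torus.IsClassicalScalarTransportOn (Icc 0 2) 0 (v m) (ρ m))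
    (hρ1 : ∀ m, ∀ t ∈ Icc (0 : ℝ) 2, ∫ x, ρ m t x ^ 2 = 1)
    (hL2 : Tendsto (fun m => ⨆ t ∈ Icc (0 : ℝ) 2, eLpNorm (θ m t - ρ m t) 2 volume) atTop (𝓝 0))
    {t : ℝ} (ht : t ∈ Icc (0 : ℝ) 2) :
    Tendsto (fun m => eLpNorm (θ m t) 2 volume) atTop (𝓝 1) := by
  have hθs : ∀ m, FunctionSpaces.Torus.IsSmooth (θ m t) := fun m => (hθ m).smooth_scalar.isSmooth_slice ht
  have hρs : ∀ m, FunctionSpaces.Torus.IsSmooth (ρ m t) := fun m => (hρ m).smooth_scalar.isSmooth_slice ht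
  have hρn : ∀ m, eLpNorm (ρ m t) 2 volume = 1 := fun m =>
    eLpNorm_two_eq_one_of_integral_sq ((hρs m).memLp 2) (hρ1 m t ht)
  have hε : Tendsto (fun m => eLpNorm (θ m t - ρ m t) 2 volume) atTop (𝓝 0) :=
    tendsto_of_tendsto_of_tendsto_of_le_of_le tendsto_const_nhds hL2 (fun _ => zero_le)
      (fun m => le_iSup₂ (f := fun s (_ : s ∈ Icc (0 : ℝ) 2) => eLpNorm (θ m s - ρ m s) 2 volume) t ht)
  have hup : ∀ m, eLpNorm (θ m t) 2 volume ≤ 1 + eLpNorm (θ m t - ρ m t) 2 volume := fun m => by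
    have h := eLpNorm_add_le (μ := (volume : Measure (UnitAddTorus (Fin 2)))) (p := 2)
      (hρs m).continuous.aestronglyMeasurable ((hθs m).sub (hρs m)).continuous.aestronglyMeasurable one_le_two
    rw [add_sub_cancel, hρn m] at h
    exact h
  have hlow : ∀ m, 1 - eLpNorm (θ m t - ρ m t) 2 volume ≤ eLpNorm (θ m t) 2 volume := fun m => by
    refine tsub_le_iff_right.2 ?_
    have h := eLpNorm_add_le (μ := (volume : Measure (UnitAddTorus (Fin 2)))) (p := 2)
      (hθs m).continuous.aestronglyMeasurable ((hρs m).sub (hθs m)).continuous.aestronglyMeasurable one_le_two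
    rw [add_sub_cancel, hρn m, eLpNorm_sub_comm] at h
    exact h
  refine tendsto_of_tendsto_of_tendsto_of_le_of_le ?_ ?_ hlow hup
  · have h := ENNReal.Tendsto.sub (tendsto_const_nhds (x := (1 : ℝ≥0∞))) hε (Or.inl ENNReal.one_ne_top)
    rw [tsub_zero] at h
    exact h
  · have h := (tendsto_const_nhds (x := (1 : ℝ≥0∞))).add hε
    rw [add_zero] at h
    exact h

/-- Real form: `∫ θ^m(t)² → 1` for `t ∈ [0,2]` (Cheskidov 2023, (4.20)). [cite: Cheskidov2023, (4.20)] -/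
theorem tendsto_integral_sq_scalar
    (hθ : ∀ m, Torus.IsClassicalScalarTransportOn (Icc 0 2) (ν m) (v m) (θ m))
    (hρ : ∀ m, Torus.IsClassicalScalarTransportOn (Icc 0 2) 0 (v m) (ρ m))
    (hρ1 : ∀ m, ∀ t ∈ Icc (0 : ℝ) 2, ∫ x, ρ m t x ^ 2 = 1)
    (hL2 : Tendsto (fun m => ⨆ t ∈ Icc (0 : ℝ) 2, eLpNorm (θ m t - ρ m t) 2 volume) atTop (𝓝 0))
    {t : ℝ} (ht : t ∈ Icc (0 : ℝ) 2) :
    Tendsto (fun m => ∫ x, θ m t x ^ 2) atTop (𝓝 1) := by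
  have h := tendsto_eLpNorm_scalar hθ hρ hρ1 hL2 ht
  have hmem : ∀ m, MemLp (θ m t) 2 volume := fun m => ((hθ m).smooth_scalar.isSmooth_slice ht).memLp 2
  have h2 := (ENNReal.tendsto_toReal ENNReal.one_ne_top).comp h
  have h3 : Tendsto (fun m => Real.sqrt (∫ x, θ m t x ^ 2)) atTop (𝓝 1) := by
    rw [ENNReal.toReal_one] at h2
    refine h2.congr fun m => ?_
    rw [Function.comp_apply, eLpNorm_two_eq_ofReal_sqrt_integral_sq (hmem m),
      ENNReal.toReal_ofReal (Real.sqrt_nonneg _)]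
  have h4 := h3.pow 2
  rw [one_pow] at h4
  refine h4.congr fun m => ?_
  exact Real.sq_sqrt (integral_nonneg fun _ => sq_nonneg _)

/-- **No loss of energy in the family**: `‖u^m(t)‖_{L²} → 1` for every `t ∈ [1,2]`, where
`u^m(t) = (0, θ^m(t)) ∘ π` (Cheskidov 2023, Thm. 2.1, second subfamily with `e = 0`:
`E(t) = lim ‖u^{ν_j}(t)‖² = 1 - e = 1` on `[1,2]`, "hence `u^{ν_j}(t)` does not converge
strongly in `L²` to `u(t)`"). [cite: Cheskidov2023, Thm. 2.1] -/
theorem tendsto_eLpNorm_family (hv0 : ∀ m, ∀ t ∉ Ioo (0 : ℝ) 1, v m t = 0)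
    (hθ : ∀ m, Torus.IsClassicalScalarTransportOn (Icc 0 2) (ν m) (v m) (θ m))
    (hρ : ∀ m, Torus.IsClassicalScalarTransportOn (Icc 0 2) 0 (v m) (ρ m))
    (hρ1 : ∀ m, ∀ t ∈ Icc (0 : ℝ) 2, ∫ x, ρ m t x ^ 2 = 1)
    (hL2 : Tendsto (fun m => ⨆ t ∈ Icc (0 : ℝ) 2, eLpNorm (θ m t - ρ m t) 2 volume) atTop (𝓝 0))
    {t : ℝ} (ht : t ∈ Icc (1 : ℝ) 2) :
    Tendsto (fun m => eLpNorm (twoHalf (v m t) (θ m t)) 2 volume) atTop (𝓝 1) := by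
  have ht' : t ∈ Icc (0 : ℝ) 2 := ⟨zero_le_one.trans ht.1, ht.2⟩
  refine (tendsto_eLpNorm_scalar hθ hρ hρ1 hL2 ht').congr fun m => ?_
  rw [hv0 m t (fun h' => not_lt.2 ht.1 h'.2), Torus.eLpNorm_twoHalf_zero_left
    ((hθ m).smooth_scalar.isSmooth_slice ht').continuous.aestronglyMeasurable]

/-- **No dissipation anomaly in the family**: `ν_m ∫₀ᵗ ‖∇u^m‖²_{L²} dt → 0` for every
`t ∈ [0,2]` (Cheskidov 2023: `‖∇u^m‖² = ‖∇v^m‖² + ‖∇θ^m‖²` with `ν_m∫₀²‖∇v^m‖² → 0`, Lemma 3.2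
(3.16), and `2ν_m∫₀²‖∇θ^m‖² = 1 - ‖θ^m(2)‖² → 0` by the energy equality and (4.20), "there is
no dissipation anomaly on the whole interval `[0,2]`", p. 13). [cite: Cheskidov2023, Lemma 3.2 and p. 13] -/
theorem tendsto_cumulativeDissipation_family (hν : ∀ m, 0 < ν m)
    (hvS : ∀ m, FunctionSpaces.Torus.IsSmoothSpaceTimeOn univ (v m))
    (hθ : ∀ m, Torus.IsClassicalScalarTransportOn (Icc 0 2) (ν m) (v m) (θ m))
    (hE : ∀ m, ∀ t ∈ Icc (0 : ℝ) 2,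
      (∫ x, θ m t x ^ 2) + 2 * ν m * ∫ s in (0 : ℝ)..t, Torus.scalarGradNormSq (θ m s) = 1)
    (hgv : Tendsto (fun m => ν m * ∫ t in (0 : ℝ)..2, FunctionSpaces.Torus.gradNormSq (v m t)) atTop (𝓝 0))
    (hθ2 : Tendsto (fun m => ∫ x, θ m 2 x ^ 2) atTop (𝓝 1)) {t : ℝ} (ht : t ∈ Icc (0 : ℝ) 2) :
    Tendsto (fun m => FunctionSpaces.Torus.cumulativeDissipation (ν m)
      (fun s => twoHalf (v m s) (θ m s)) 0 t) atTop (𝓝 0) := by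
  have h0 : (0 : ℝ) ∈ Icc (0 : ℝ) 2 := ⟨le_rfl, zero_le_two⟩
  have h2 : (2 : ℝ) ∈ Icc (0 : ℝ) 2 := ⟨zero_le_two, le_rfl⟩
  have hcv : ∀ m, ContinuousOn (fun s => FunctionSpaces.Torus.gradNormSq (v m s)) (Icc 0 2) := fun m =>
    ((hvS m).continuousOn_gradNormSq convex_univ uniqueDiffOn_univ).mono (subset_univ _)
  have hcθ : ∀ m, ContinuousOn (fun s => Torus.scalarGradNormSq (θ m s)) (Icc 0 2) := fun m =>
    (hθ m).smooth_scalar.continuousOn_scalarGradNormSq (convex_Icc 0 2) (uniqueDiffOn_Icc zero_lt_two)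
  have hiv : ∀ m, ∀ b ∈ Icc (0 : ℝ) 2,
      IntervalIntegrable (fun s => FunctionSpaces.Torus.gradNormSq (v m s)) volume 0 b :=
    fun m b hb => ((hcv m).mono (uIcc_subset_Icc h0 hb)).intervalIntegrable
  have hiθ : ∀ m, ∀ b ∈ Icc (0 : ℝ) 2,
      IntervalIntegrable (fun s => Torus.scalarGradNormSq (θ m s)) volume 0 b :=
    fun m b hb => ((hcθ m).mono (uIcc_subset_Icc h0 hb)).intervalIntegrable
  have hsplit : ∀ m, FunctionSpaces.Torus.cumulativeDissipation (ν m) (fun s => twoHalf (v m s) (θ m s)) 0 t =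
      (ν m * ∫ s in (0 : ℝ)..t, FunctionSpaces.Torus.gradNormSq (v m s)) +
        ν m * ∫ s in (0 : ℝ)..t, Torus.scalarGradNormSq (θ m s) := by
    intro m
    unfold FunctionSpaces.Torus.cumulativeDissipation
    rw [← mul_add, ← intervalIntegral.integral_add (hiv m t ht) (hiθ m t ht)]
    congr 1
    refine intervalIntegral.integral_congr fun s hs => ?_
    have hs' : s ∈ Icc (0 : ℝ) 2 := (uIcc_subset_Icc h0 ht) hs
    exact Torus.gradNormSq_twoHalf ((hvS m).isSmooth_slice (mem_univ s))
      ((hθ m).smooth_scalar.isSmooth_slice hs')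
  rw [show (𝓝 (0 : ℝ)) = 𝓝 (0 + 0) by rw [add_zero]]
  refine Tendsto.congr (fun m => (hsplit m).symm) (Tendsto.add ?_ ?_)
  · refine tendsto_of_tendsto_of_tendsto_of_le_of_le tendsto_const_nhds hgv (fun m => ?_) (fun m => ?_)
    · exact mul_nonneg (hν m).le (intervalIntegral.integral_nonneg ht.1 fun s _ =>
        FunctionSpaces.Torus.gradNormSq_nonneg _)
    · exact mul_le_mul_of_nonneg_left (intervalIntegral.integral_mono_interval le_rfl ht.1 ht.2
        (Eventually.of_forall fun s => FunctionSpaces.Torus.gradNormSq_nonneg _) (hiv m 2 h2)) (hν m).le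
  · have hlim : Tendsto (fun m => ν m * ∫ s in (0 : ℝ)..2, Torus.scalarGradNormSq (θ m s)) atTop (𝓝 0) := by
      have heq : ∀ m, ν m * ∫ s in (0 : ℝ)..2, Torus.scalarGradNormSq (θ m s) =
          (1 - ∫ x, θ m 2 x ^ 2) / 2 := fun m => by
        have := hE m 2 h2
        linarith
      have h := ((tendsto_const_nhds (x := (1 : ℝ))).sub hθ2).div_const 2
      rw [sub_self, zero_div] at h
      exact h.congr fun m => (heq m).symm
    refine tendsto_of_tendsto_of_tendsto_of_le_of_le tendsto_const_nhds hlim (fun m => ?_) (fun m => ?_)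
    · exact mul_nonneg (hν m).le (intervalIntegral.integral_nonneg ht.1 fun s _ =>
        Torus.scalarGradNormSq_nonneg _)
    · exact mul_le_mul_of_nonneg_left (intervalIntegral.integral_mono_interval le_rfl ht.1 ht.2
        (Eventually.of_forall fun s => Torus.scalarGradNormSq_nonneg _) (hiθ m 2 h2)) (hν m).le

/-- **Weak convergence to zero of the family on `[1,2]`**: for `t ∈ [1,2]` and every
`w ∈ L²(T³; ℝ³)`, `∫ ⟪u^m(t), w⟫ → 0`, where `u^m(t) = (0, θ^m(t)) ∘ π` (Cheskidov 2023, Thm. 2.1: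
`u^{ν_j} → u` in `C_w([0,2]; L²)` with `u(t) = 0` on `[1,2]`; here from `θ^m(t) - ρ^m(1) → 0` in
`L²`, `ρ^m(t) = ρ^m(1)` on `[1,2]`, and the vanishing of the Fourier modes of the mixed scalars
`ρ^m(1)`: zero mean and `‖ρ^m(1)‖_{Ḣ⁻¹} ≤ C 5^{-m}`, (3.6)). [cite: Cheskidov2023, Thm. 2.1 and (3.6)] -/
theorem tendsto_integral_inner_family_of_mem_Icc (hv0 : ∀ m, ∀ t ∉ Ioo (0 : ℝ) 1, v m t = 0)
    (hθ : ∀ m, Torus.IsClassicalScalarTransportOn (Icc 0 2) (ν m) (v m) (θ m))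
    (hρ : ∀ m, Torus.IsClassicalScalarTransportOn (Icc 0 2) 0 (v m) (ρ m))
    (hρfr : ∀ m, ∀ t ∈ Icc (1 : ℝ) 2, ρ m t = ρ m 1)
    (hρ0 : ∀ m, ∀ t ∈ Icc (0 : ℝ) 2, FunctionSpaces.Torus.HasZeroMean (ρ m t))
    (hH : ∃ C : ℝ, ∀ m : ℕ, FunctionSpaces.Torus.eHomSobolevSeminorm (-1) (fun x => (ρ m 1 x : ℂ)) ≤
      ENNReal.ofReal (C * (5 ^ m)⁻¹))
    (hE : ∀ m, ∀ t ∈ Icc (0 : ℝ) 2,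
      (∫ x, θ m t x ^ 2) + 2 * ν m * ∫ s in (0 : ℝ)..t, Torus.scalarGradNormSq (θ m s) = 1)
    (hν : ∀ m, 0 < ν m)
    (hL2 : Tendsto (fun m => ⨆ t ∈ Icc (0 : ℝ) 2, eLpNorm (θ m t - ρ m t) 2 volume) atTop (𝓝 0))
    {t : ℝ} (ht : t ∈ Icc (1 : ℝ) 2) {w : UnitAddTorus (Fin 3) → EuclideanSpace ℝ (Fin 3)}
    (hw : MemLp w 2 volume) :
    Tendsto (fun m => ∫ x, ⟪twoHalf (v m t) (θ m t) x, w x⟫_ℝ) atTop (𝓝 0) := by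
  have ht' : t ∈ Icc (0 : ℝ) 2 := ⟨zero_le_one.trans ht.1, ht.2⟩
  have h1 : (1 : ℝ) ∈ Icc (0 : ℝ) 2 := ⟨zero_le_one, one_le_two⟩
  have hθs : ∀ m, FunctionSpaces.Torus.IsSmooth (θ m t) := fun m => (hθ m).smooth_scalar.isSmooth_slice ht'
  have hρs : ∀ m, FunctionSpaces.Torus.IsSmooth (ρ m 1) := fun m => (hρ m).smooth_scalar.isSmooth_slice h1
  -- `L²` bound from the energy equality
  have hbd : ∀ m, ∫ x, θ m t x ^ 2 ≤ 1 := fun m => by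
    have h := hE m t ht'
    have hI : 0 ≤ ∫ s in (0 : ℝ)..t, Torus.scalarGradNormSq (θ m s) :=
      intervalIntegral.integral_nonneg ht'.1 fun s _ => Torus.scalarGradNormSq_nonneg _
    nlinarith [hν m]
  -- Fourier modes of the frozen mixed scalars vanish
  have hρcoef : ∀ k : Fin 2 → ℤ, Tendsto (fun m => mFourierCoeff (fun y => (ρ m 1 y : ℂ)) k) atTop (𝓝 0) := by
    obtain ⟨C, hC⟩ := hH
    refine Torus.tendsto_mFourierCoeff_of_tendsto_eHomSobolevSeminorm ?_ ?_
    · refine tendsto_of_tendsto_of_tendsto_of_le_of_le tendsto_const_nhds ?_ (fun _ => zero_le) hC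
      rw [← ENNReal.ofReal_zero]
      refine ENNReal.tendsto_ofReal ?_
      rw [show (0 : ℝ) = C * 0 by rw [mul_zero]]
      refine Tendsto.const_mul C ?_
      simp_rw [← inv_pow]
      exact tendsto_pow_atTop_nhds_zero_of_lt_one (by norm_num) (by norm_num)
    · refine tendsto_const_nhds.congr fun m => ?_
      rw [FunctionSpaces.Torus.mFourierCoeff_eq_integral_volume]
      simp only [neg_zero, mFourier_zero, ContinuousMap.one_apply, one_smul, integral_complex_ofReal]
      rw [show (∫ y, ρ m 1 y) = 0 from hρ0 m 1 h1, Complex.ofReal_zero]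
  -- hence those of `θ^m(t)`
  have hcoef : ∀ k : Fin 2 → ℤ, Tendsto (fun m => mFourierCoeff (fun y => (θ m t y : ℂ)) k) atTop (𝓝 0) := by
    intro k
    have hdiff : Tendsto (fun m => mFourierCoeff (fun y => (θ m t y : ℂ)) k -
        mFourierCoeff (fun y => (ρ m 1 y : ℂ)) k) atTop (𝓝 0) := by
      rw [tendsto_zero_iff_norm_tendsto_zero]
      have hb : ∀ m, ‖mFourierCoeff (fun y => (θ m t y : ℂ)) k - mFourierCoeff (fun y => (ρ m 1 y : ℂ)) k‖ₑ ≤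
          ⨆ s ∈ Icc (0 : ℝ) 2, eLpNorm (θ m s - ρ m s) 2 volume := fun m => by
        refine (Torus.enorm_mFourierCoeff_ofReal_sub_le (hθs m).integrable (hρs m).integrable k).trans ?_
        rw [← hρfr m t ht]
        exact le_iSup₂ (f := fun s (_ : s ∈ Icc (0 : ℝ) 2) => eLpNorm (θ m s - ρ m s) 2 volume) t ht'
      have hen := tendsto_of_tendsto_of_tendsto_of_le_of_le tendsto_const_nhds hL2 (fun _ => zero_le) hb
      have h := (ENNReal.tendsto_toReal ENNReal.zero_ne_top).comp hen
      rw [ENNReal.toReal_zero] at h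
      exact h.congr fun m => by simp
    have h := hdiff.add (hρcoef k)
    rw [add_zero] at h
    exact h.congr fun m => by abel
  have h := Torus.tendsto_integral_inner_twoHalf_zero_left (l := atTop) (r := fun m => θ m t) (M := 1)
    (fun m => (hθs m).memLp 2) hbd hcoef hw
  refine h.congr fun m => ?_
  rw [hv0 m t (fun h' => not_lt.2 ht.1 h'.2)]

end Family

end Literature.Analysis.FluidPDE.Cheskidov

end
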